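import Summits.ResolutionOfSingularities.ResolutionOfSingularities.Theorems.UniformComplexityPrimeModelTransferSpecializationLemmas
import Literature.AlgebraicGeometry.Limits.LocalizationIsoSpread
import Mathlib.AlgebraicGeometry.Stalk
import Literature.AlgebraicGeometry.Resolution.BlowupsFlatBaseChange
import Mathlib.AlgebraicGeometry.Morphisms.Preimmersion
import HarnessLib

/-!
# Crux `PrimeModelTransfer` (stmt-ResolutionOfSingularities-8933), door 2 of slot W8.2:
# lemmas for SPREADING a resolution of the geometric generic fibre — isomorphism over `Spec 𝒪_{X,x}`
# spreads to an open neighbourhood of ANY point `x`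

Route `ResolutionOfSingularities/UniformComplexity`. Helper lemmas (Theses-free) for the «⇒» half of
the FAMILY FORM of the crux (`Theorems/UniformComplexityCampaignW82FamilyResolution.lean`, p526769:
`CampaignW82.FamilyResolution k`; «⇐» in `Theorems/UniformComplexityPrimeModelTransferOfFamilyResolution.lean`):
to spread a resolution of the geometric generic fibre of a family `𝒳 → Spec R` over an open of the
base one needs an open `W` of the TOTAL space `𝒳 ×_R R'` (not of the generic fibre) over which the
spread morphism is an isomorphism, through the image `ξ` of the generic point of the generic fibre —
a point of a possibly NON-integral scheme. The generic-point lemma of the specialization file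
(`exists_isIso_morphismRestrict_of_isIso_pullback_snd_fromSpecStalk`, p483756: `X` integral, `x` its
generic point, `𝒪_{X,x} = Frac Γ(X, V)`) is therefore generalised here to an ARBITRARY point
(`𝒪_{X,x} = Γ(X, V)_𝔭`, the tree's localization diagram `Limits.LocApprox` for the submonoid
`𝔭.primeCompl`):

* `exists_mem_isIso_morphismRestrict_of_isIso_pullback_snd_fromSpecStalk` — `G : Y → X` quasi-compact,
  quasi-separated, locally of finite presentation, an isomorphism after base change to `Spec 𝒪_{X,x}`
  ⇒ an isomorphism over an open `W ∋ x` (Görtz–Wedhorn I Cor. 10.64 (2) / EGA IV₃ 8.8.2.5);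
* `isIso_pullback_snd_fromSpecStalk_of_flat_of_isPreimmersion` — the hypothesis transports along a
  flat preimmersion `ℓ : X' → X` (e.g. the inclusion of the generic fibre of a family over a domain):
  if `G ×_X X'` is an isomorphism over `Spec 𝒪_{X',x'}` then `G` is one over `Spec 𝒪_{X,ℓ x'}`
  (stalk maps of flat preimmersions are isomorphisms, tree `Resolution.isIso_stalkMap_of_flat_of_isPreimmersion`;
  Mathlib `Scheme.SpecMap_stalkMap_fromSpecStalk`);
* two bookkeeping lemmas on `IsIso (pullback.snd G _)`.

[OURS · LADDER-RESOLUTION L1, slot W8.2 (prime-field / universality transfer), door 2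
UniformComplexity] Helper lemmas over the summit's own route; NOT statements of, and attributing
nothing to, Hironaka's 2017 manuscript. AI-written; weaker than expert review. No base change of a
resolution along an inseparable extension occurs here.

Sources: U. Görtz, T. Wedhorn, *Algebraic Geometry I* (2nd ed. 2020) Cor. 10.64 (2); A. Grothendieck,
J. Dieudonné, EGA IV₃ (1966) 8.8.2.5; The Stacks Project, Tag 01ZM.
[cite: GortzWedhorn2020, Cor. 10.64 (2)] [cite: EGAIV3, 8.8.2.5] [cite: StacksProject, Tag 01ZM]
-/

noncomputable section

set_option linter.dupNamespace false -- mandated namespace of this single-conjunct summit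

open CategoryTheory CategoryTheory.Limits AlgebraicGeometry TopologicalSpace
open Literature.AlgebraicGeometry.Resolution

namespace Summit.ResolutionOfSingularities.ResolutionOfSingularities.Theorems.PrimeModelTransfer

open Literature.AlgebraicGeometry.Limits
open Literature.AlgebraicGeometry.Motives (SchemeOver specOver)

set_option backward.isDefEq.respectTransparency false

/-- **An isomorphism over `Spec 𝒪_{X,x}` spreads to an open neighbourhood of `x`** (EGA IV₃ 8.8.2.5 /
Görtz–Wedhorn I, Cor. 10.64 (2), for the localization diagram `Spec 𝒪_{X,x} = Spec A_𝔭 = lim Spec A[1/t]`,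
`t ∉ 𝔭`, of an affine neighbourhood `Spec A ∋ x`; through the tree's
`Limits.LocApprox.exists_pullback_iso_of_pullback_iso`): let `G : Y → X` be quasi-compact,
quasi-separated and locally of finite presentation, and `x ∈ X` ANY point such that the base change of
`G` along `Spec 𝒪_{X,x} → X` is an isomorphism. Then `G` restricts to an isomorphism over some open
`W ∋ x`. (The point-wise generalisation of `exists_isIso_morphismRestrict_of_isIso_pullback_snd_fromSpecStalk`,
p483756, which took `X` integral and `x` its generic point.) [cite: GortzWedhorn2020, Cor. 10.64 (2)] -/
theorem exists_mem_isIso_morphismRestrict_of_isIso_pullback_snd_fromSpecStalk {Y X : Scheme.{0}}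
    (G : Y ⟶ X) [QuasiCompact G] [QuasiSeparated G] [LocallyOfFinitePresentation G] (x : X)
    [hiso : IsIso (pullback.snd G (X.fromSpecStalk x))] :
    ∃ W : X.Opens, x ∈ W ∧ IsIso (G ∣_ W) := by
  classical
  -- an affine open `V ∋ x`, `A = Γ(X, V)`, `𝒪_{X,x} = A_𝔭`
  obtain ⟨_, ⟨V, hV, rfl⟩, hxV, -⟩ :=
    X.isBasis_affineOpens.exists_subset_of_mem_open (Set.mem_univ x) isOpen_univ
  let A : Type := Γ(X, V)
  let B : Type := X.presheaf.stalk x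
  letI : Algebra A B := X.presheaf.algebra_section_stalk ⟨x, hxV⟩
  let 𝔭 : PrimeSpectrum A := hV.primeIdealOf ⟨x, hxV⟩
  haveI : IsLocalization.AtPrime B 𝔭.asIdeal := hV.isLocalization_stalk ⟨x, hxV⟩
  -- the two `A`-schemes `G⁻¹(V) → Spec A` and `Spec A`
  let P₁ : SchemeOver A := Over.mk (pullback.snd G hV.fromSpec)
  let P₂ : SchemeOver A := Over.mk (𝟙 (Spec (.of A)))
  haveI : QuasiCompact P₁.hom := inferInstanceAs (QuasiCompact (pullback.snd G hV.fromSpec))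
  haveI : QuasiSeparated P₁.hom := inferInstanceAs (QuasiSeparated (pullback.snd G hV.fromSpec))
  haveI : LocallyOfFinitePresentation P₁.hom :=
    inferInstanceAs (LocallyOfFinitePresentation (pullback.snd G hV.fromSpec))
  haveI : QuasiCompact P₂.hom := inferInstanceAs (QuasiCompact (𝟙 _))
  haveI : QuasiSeparated P₂.hom := inferInstanceAs (QuasiSeparated (𝟙 _))
  haveI : LocallyOfFinitePresentation P₂.hom := inferInstanceAs (LocallyOfFinitePresentation (𝟙 _))
  -- `Spec 𝒪_{X,x} → Spec A → X` is `Spec 𝒪_{X,x} → X`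
  have hgen : Spec.map (CommRingCat.ofHom (algebraMap A B)) ≫ hV.fromSpec = X.fromSpecStalk x := by
    rw [← hV.fromSpecStalk_eq_fromSpecStalk hxV, IsAffineOpen.fromSpecStalk]
    rfl
  -- over `Spec 𝒪_{X,x}` both become isomorphic (to `Spec 𝒪_{X,x}`)
  haveI h1 : IsIso (pullback.snd P₁.hom (Spec.map (CommRingCat.ofHom (algebraMap A B)))) := by
    change IsIso (pullback.snd (pullback.snd G hV.fromSpec) (Spec.map (CommRingCat.ofHom (algebraMap A B))))
    rw [← pullbackLeftPullbackSndIso_hom_snd G hV.fromSpec]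
    have e : pullback.snd G (Spec.map (CommRingCat.ofHom (algebraMap A B)) ≫ hV.fromSpec) =
        (pullback.congrHom rfl hgen).hom ≫ pullback.snd G (X.fromSpecStalk x) := by
      rw [pullback.congrHom_hom, pullback.lift_snd, Category.comp_id]
    haveI : IsIso (pullback.snd G (Spec.map (CommRingCat.ofHom (algebraMap A B)) ≫ hV.fromSpec)) := by
      rw [e]; infer_instance
    infer_instance
  haveI h2 : IsIso (pullback.snd P₂.hom (Spec.map (CommRingCat.ofHom (algebraMap A B)))) :=
    inferInstanceAs (IsIso (pullback.snd (𝟙 _) (Spec.map (CommRingCat.ofHom (algebraMap A B)))))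
  let k : (Over.pullback (specOver A B).hom).obj P₁ ≅ (Over.pullback (specOver A B).hom).obj P₂ :=
    Over.isoMk (@asIso _ _ _ _ (pullback.snd P₁.hom (Spec.map (CommRingCat.ofHom (algebraMap A B)))) h1 ≪≫
      (@asIso _ _ _ _ (pullback.snd P₂.hom (Spec.map (CommRingCat.ofHom (algebraMap A B)))) h2).symm) (by
        show (pullback.snd P₁.hom (Spec.map (CommRingCat.ofHom (algebraMap A B))) ≫
            inv (pullback.snd P₂.hom (Spec.map (CommRingCat.ofHom (algebraMap A B))))) ≫
            pullback.snd P₂.hom (Spec.map (CommRingCat.ofHom (algebraMap A B))) =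
          pullback.snd P₁.hom (Spec.map (CommRingCat.ofHom (algebraMap A B)))
        rw [Category.assoc, @IsIso.inv_hom_id _ _ _ _ _ h2, Category.comp_id])
  -- hence over some `D(t)`, `t ∉ 𝔭`
  obtain ⟨t, ⟨e⟩⟩ := LocApprox.exists_pullback_iso_of_pullback_iso
    (S := 𝔭.asIdeal.primeCompl) (B := B) k
  let T : Type := Localization.Away t.val
  let i : Spec (.of T) ⟶ Spec (.of A) := Spec.map (CommRingCat.ofHom (algebraMap A T))
  have hi : ((LocApprox.baseDiagram (𝔭.asIdeal.primeCompl)).obj t).hom = i := rfl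
  haveI : IsIso (pullback.snd P₂.hom i) := inferInstanceAs (IsIso (pullback.snd (𝟙 _) i))
  have h3 : IsIso (pullback.snd (pullback.snd G hV.fromSpec) i) := by
    have w := Over.w e.hom
    haveI : IsIso e.hom.left := ((Over.forget _).mapIso e).isIso_hom
    haveI : IsIso ((Over.pullback ((LocApprox.baseDiagram (𝔭.asIdeal.primeCompl)).obj t).hom).obj P₂).hom :=
      inferInstanceAs (IsIso (pullback.snd (𝟙 _) i))
    change IsIso ((Over.pullback ((LocApprox.baseDiagram (𝔭.asIdeal.primeCompl)).obj t).hom).obj P₁).hom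
    rw [← w]
    infer_instance
  -- i.e. `G` is an isomorphism over the open `W = D(t) ⊆ V ⊆ X`, which contains `x`
  haveI : IsOpenImmersion i := IsOpenImmersion.of_isLocalization t.val
  let j : Spec (.of T) ⟶ X := i ≫ hV.fromSpec
  haveI : IsIso (pullback.snd G j) := by
    change IsIso (pullback.snd G (i ≫ hV.fromSpec))
    rw [← pullbackLeftPullbackSndIso_inv_snd_snd G hV.fromSpec i]
    infer_instance
  refine ⟨j.opensRange, ?_, ?_⟩
  · -- `x = fromSpec 𝔭` and `𝔭 ∈ D(t) = range (Spec A[1/t] → Spec A)` since `t ∉ 𝔭`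
    have hx : hV.fromSpec 𝔭 = x := hV.fromSpec_primeIdealOf ⟨x, hxV⟩
    have h𝔭 : 𝔭 ∈ i.opensRange := by
      have hr : i.opensRange = PrimeSpectrum.basicOpen t.val :=
        Scheme.Hom.opensRange_localizationAway (R := CommRingCat.of A) t.val
      rw [hr]
      exact (PrimeSpectrum.mem_basicOpen _ _).mpr t.mem
    obtain ⟨q, hq⟩ := h𝔭
    exact ⟨q, by change hV.fromSpec (i q) = x; rw [hq, hx]⟩
  · exact ((MorphismProperty.isomorphisms Scheme.{0}).arrow_mk_iso_iff
      (morphismRestrictOpensRange G j)).mpr ‹IsIso (pullback.snd G j)›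


/-- If the base change of `G` along `e ≫ h` is an isomorphism and `e` is an isomorphism, then the
base change of `G` along `h` is an isomorphism. [folklore] -/
theorem isIso_pullback_snd_of_isIso_pullback_snd_iso_comp {Y X S S' : Scheme.{0}} (G : Y ⟶ X)
    (h : S ⟶ X) (e : S' ⟶ S) [IsIso e] [IsIso (pullback.snd G (e ≫ h))] :
    IsIso (pullback.snd G h) := by
  haveI : IsIso (pullback.snd (pullback.snd G h) e) := by
    rw [← pullbackLeftPullbackSndIso_hom_snd G h e]; infer_instance
  have heq : pullback.snd G h =
      inv (pullback.fst (pullback.snd G h) e) ≫ pullback.snd (pullback.snd G h) e ≫ e := by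
    rw [IsIso.eq_inv_comp, pullback.condition]
  rw [heq]
  infer_instance

/-- Transport of "the base change along `Spec 𝒪 → X` is an isomorphism" along an equality of the
base-change maps. [folklore] -/
theorem isIso_pullback_snd_congr {Y X S : Scheme.{0}} (G : Y ⟶ X) {c₁ c₂ : S ⟶ X} (e : c₁ = c₂)
    [IsIso (pullback.snd G c₁)] : IsIso (pullback.snd G c₂) := by
  subst e; infer_instance

/-- **"Isomorphism over `Spec 𝒪_{X',x'}`" descends along a flat preimmersion `ℓ : X' → X` to
"isomorphism over `Spec 𝒪_{X, ℓ x'}`"** — e.g. along the inclusion of the generic fibre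
`X ×_A Spec (Frac A) → X` of a family over a domain `A`: the stalk map `𝒪_{X,ℓ x'} → 𝒪_{X',x'}` of a
flat preimmersion is an isomorphism (tree: `Resolution.isIso_stalkMap_of_flat_of_isPreimmersion`), and
`Spec 𝒪_{X',x'} → X' → X` is `Spec 𝒪_{X',x'} ≅ Spec 𝒪_{X,ℓ x'} → X` (Mathlib
`Scheme.SpecMap_stalkMap_fromSpecStalk`). [folklore] -/
theorem isIso_pullback_snd_fromSpecStalk_of_flat_of_isPreimmersion {Y X X' : Scheme.{0}}
    (G : Y ⟶ X) (ℓ : X' ⟶ X) [Flat ℓ] [IsPreimmersion ℓ] (x' : X')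
    [h : IsIso (pullback.snd (pullback.snd G ℓ) (X'.fromSpecStalk x'))] :
    IsIso (pullback.snd G (X.fromSpecStalk (ℓ x'))) := by
  haveI h1 : IsIso (pullback.snd G (X'.fromSpecStalk x' ≫ ℓ)) := by
    rw [← pullbackLeftPullbackSndIso_inv_snd_snd G ℓ (X'.fromSpecStalk x')]; infer_instance
  haveI : IsIso (ℓ.stalkMap x') :=
    Literature.AlgebraicGeometry.Resolution.isIso_stalkMap_of_flat_of_isPreimmersion ℓ x'
  haveI h2 : IsIso (pullback.snd G (Spec.map (ℓ.stalkMap x') ≫ X.fromSpecStalk (ℓ x'))) :=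
    isIso_pullback_snd_congr G (Scheme.SpecMap_stalkMap_fromSpecStalk ℓ).symm
  exact isIso_pullback_snd_of_isIso_pullback_snd_iso_comp G (X.fromSpecStalk (ℓ x'))
    (Spec.map (ℓ.stalkMap x'))

end Summit.ResolutionOfSingularities.ResolutionOfSingularities.Theorems.PrimeModelTransfer

end
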